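import Mathlib
import Literature.Analysis.FluidPDE.SelfSimilarEulerProfileVorticity
import HarnessLib

/-!
# Crux `EulerZoomLiouville.PowerGaugeEulerLiouville` (stmt-NavierStokesRegularity-19832), line `relative_equilibria`
# (R2, spiral vortical escape): the SPIRAL VORTICITY IDENTITY — vorticity transport along the spiral similarity wind

Route №10 `EulerZoomLiouville` (NavierStokesRegularity), crux E = stmt-NavierStokesRegularity-19832.  Portrait bricks for
the O(3)-TWISTED self-similar stratum (Perelman's spiral ansatz; line `Cruxes/PowerGaugeEulerLiouville/Lines/relative_equilibria.lean`,
stub R2 `stub_spiralTame`, typed first lemma `Sig.lemma_spiralVorticalEscape`; obstruction memo `R2-ESC-OBSTRUCTION.md`,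
evidence #50/#51 on the crux item, §1(a)).  For a CLASSICAL SPIRAL PROFILE — `V ∈ C²`, `P ∈ C¹`, `div V = 0` and
`(1−γ)V − SV + (W_S·∇)V + ∇P = 0` with the SPIRAL WIND `W_S(y) = V(y) + γy + Sy`, `S` skew-adjoint (the line's
`RelativeEquilibria.IsSpiralProfile γ S V P`, hypotheses spelled out clause by clause so that the line file instantiates
the theorems by `exact`) — this file proves, with `Ω = curl V`:

* `curlCLM_comp_sub_comp_of_skew` — the curl algebra of a skew generator: `curl(M∘S − S∘M) = −S(curl M)` for every
  linear `M` and skew `S` (in `ℝ³`, `Sy = s × y` and this is `(M − Mᵀ)s = (curl M) × s`);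
* `curl_skew_comp`, `curl_fderiv_apply_skew` — the pointwise curls of the two twist terms:
  `curl(S∘V)(y) = curlCLM(S ∘ DV(y))`, `curl((Sy·∇)V)(y) = curlCLM(DV(y) ∘ S) + DΩ(y)[Sy]`;
* `spiral_vorticity_identity` — **the spiral vorticity equation** `DΩ(y)[W_S y] = DV(y)[Ω y] − Ω y + S(Ω y)`, i.e.
  `(W_S·∇)Ω = (Ω·∇)V − Ω + SΩ` (Pineau–Vicol's (3.3) for the Navier–Stokes analogue: the twist contributes
  `α(JΩ − (Jy·∇)Ω)`; here inviscid, general skew `S`, rate `γ`);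
* `fderiv_curl_spiralWind_sub` — the commutator identity `DΩ[W_S] − DW_S[Ω] = −(1+γ)Ω` (`DW_S = DV + γ·1 + S`): the
  vorticity is a conformally invariant field of the spiral similarity flow EXACTLY as in the untwisted case
  (`IsSelfSimilarEulerVorticityProfile.fderiv_curl_transport_sub_fderiv_transport_curl`), the twist drops out;
* `divergence_spiralWind` — `div W_S = 3γ` (`tr S = 0`).

WHAT THIS IS NOT: not NS, not E — S-free Lagrangian bookkeeping for classical spiral profiles (portrait bricks for R2 of
line `relative_equilibria`, whose open content is RECURRENCE EXCLUSION for the spiral similarity flow); the crux 19832 is OPEN.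

## References

* B. Pineau, V. Vicol, *A Liouville theorem for rotated self similar solutions to the Navier–Stokes equations and
  applications*, arXiv:2607.09619 (2026), §1.2 (1.7)–(1.8), §3 proof of Prop. 3.1, eq. (3.3). [PineauVicol2026]
* P. Constantin, M. Ignatova, V. Vicol, arXiv:2602.17570 (2026), §3.1.1 (3.3)–(3.4), §3.4.1 (3.22).
  [ConstantinIgnatovaVicol2026Putative]
* A. J. Majda, A. L. Bertozzi, *Vorticity and Incompressible Flow* (CUP 2002), §1.1 (vector identities). [MajdaBertozziCUP2002]
-/

noncomputable section

-- flat `Theorems/<Route><Decl>…` files of one crux share the namespace of the crux (tree convention)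
set_option linter.dupNamespace false

open Set Filter Topology Metric Function InnerProductSpace
open scoped RealInnerProductSpace NNReal

namespace Summit.NavierStokesRegularity.NavierStokesRegularity.Theorems.PowerGaugeEulerLiouville.Spiral

open Literature.Analysis Literature.Analysis.FluidPDE

variable {γ : ℝ} {S : EuclideanSpace ℝ (Fin 3) →L[ℝ] EuclideanSpace ℝ (Fin 3)}
  {V : EuclideanSpace ℝ (Fin 3) → EuclideanSpace ℝ (Fin 3)} {P : EuclideanSpace ℝ (Fin 3) → ℝ}

/-! ### Curl algebra of a skew generator -/

/-- Matrix entries of a skew-adjoint map in the standard frame: `(S eⱼ)ᵢ = −(S eᵢ)ⱼ`. [folklore] -/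
theorem skew_apply_single (hS : ∀ x y : EuclideanSpace ℝ (Fin 3), ⟪S x, y⟫ = -⟪x, S y⟫) (i j : Fin 3) :
    S (EuclideanSpace.single j (1 : ℝ)) i = -S (EuclideanSpace.single i (1 : ℝ)) j := by
  have h := hS (EuclideanSpace.single j 1) (EuclideanSpace.single i 1)
  rw [EuclideanSpace.inner_single_right, EuclideanSpace.inner_single_left] at h
  simpa using h

/-- Diagonal entries of a skew-adjoint map vanish: `(S eᵢ)ᵢ = 0`. [folklore] -/
theorem skew_apply_single_self (hS : ∀ x y : EuclideanSpace ℝ (Fin 3), ⟪S x, y⟫ = -⟪x, S y⟫) (i : Fin 3) :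
    S (EuclideanSpace.single i (1 : ℝ)) i = 0 := by
  have h := skew_apply_single hS i i
  linarith

/-- A skew-adjoint map of `ℝ³` is trace-free (private copy of `Spiral.trace_eq_zero_of_skew` of `…SpiralProfileEnergyRadial`,
restated to keep this module's imports light). [folklore] -/
private theorem trace_skew_eq_zero (hS : ∀ x y : EuclideanSpace ℝ (Fin 3), ⟪S x, y⟫ = -⟪x, S y⟫) :
    LinearMap.trace ℝ (EuclideanSpace ℝ (Fin 3)) (S : EuclideanSpace ℝ (Fin 3) →ₗ[ℝ] EuclideanSpace ℝ (Fin 3)) = 0 := by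
  rw [trace_eq_sum_coord, Fin.sum_univ_three, skew_apply_single_self hS 0, skew_apply_single_self hS 1,
    skew_apply_single_self hS 2]
  ring

/-- `⟪S v, v⟫ = 0` for a skew-adjoint `S` (same content as `Spiral.inner_self_of_skew` of `…SpiralProfileGradient`; restated here so
that this module imports only the Literature curl calculus). [folklore] -/
theorem inner_skew_apply_self (hS : ∀ x y : EuclideanSpace ℝ (Fin 3), ⟪S x, y⟫ = -⟪x, S y⟫)
    (v : EuclideanSpace ℝ (Fin 3)) : ⟪S v, v⟫ = 0 := by
  have h := hS v v
  rw [real_inner_comm (S v) v] at h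
  have : ⟪S v, v⟫ = ⟪v, S v⟫ := real_inner_comm _ _
  linarith

/-- **The curl algebra of a skew generator**: for every linear map `M` of `ℝ³` and every skew-adjoint `S`,
`curlCLM (M ∘ S − S ∘ M) = −S (curlCLM M)`.  (With `Sy = s × y`: `curl` of the linear field `y ↦ (MS − SM)y` is
`(M − Mᵀ)s = (curl M) × s = −S(curl M)`; this is the algebra behind `∇ × (JU) − [∇×, (Jy·∇)]U = −JΩ` in the rotating
frame.) [cite: PineauVicol2026, §3 proof of Prop. 3.1, eq. (3.3)] -/
theorem curlCLM_comp_sub_comp_of_skew (hS : ∀ x y : EuclideanSpace ℝ (Fin 3), ⟪S x, y⟫ = -⟪x, S y⟫)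
    (M : EuclideanSpace ℝ (Fin 3) →L[ℝ] EuclideanSpace ℝ (Fin 3)) :
    curlCLM (M.comp S - S.comp M) = -(S (curlCLM M)) := by
  have hd0 := skew_apply_single_self hS 0
  have hd1 := skew_apply_single_self hS 1
  have hd2 := skew_apply_single_self hS 2
  have h10 := skew_apply_single hS 0 1
  have h20 := skew_apply_single hS 0 2
  have h21 := skew_apply_single hS 1 2
  have hc1 : ∀ (v : EuclideanSpace ℝ (Fin 3)) (k : Fin 3),
      M (S v) k = ∑ m, (S v) m * M (EuclideanSpace.single m (1 : ℝ)) k := fun v k => clm_apply_coord M (S v) k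
  have hc2 : ∀ (v : EuclideanSpace ℝ (Fin 3)) (k : Fin 3),
      S (M v) k = ∑ m, (M v) m * S (EuclideanSpace.single m (1 : ℝ)) k := fun v k => clm_apply_coord S (M v) k
  have hS3 : S (curlCLM M) = ∑ m, (curlCLM M) m • S (EuclideanSpace.single m (1 : ℝ)) := by
    conv_lhs => rw [show curlCLM M = ∑ m, (curlCLM M) m • EuclideanSpace.single m (1 : ℝ) from by
      simpa using ((EuclideanSpace.basisFun (Fin 3) ℝ).sum_repr (curlCLM M)).symm]
    simp [map_sum, map_smul]
  rw [hS3]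
  ext i
  fin_cases i <;>
    simp [curlCLM_apply, Fin.sum_univ_three, hc1, hc2, hd0, hd1, hd2, h10, h20, h21] <;> ring

/-! ### Pointwise curls of the two twist terms -/

/-- `curl (S ∘ V)(y) = curlCLM (S ∘ DV(y))` for a (continuous) linear `S` and `V` differentiable at `y`. [folklore] -/
theorem curl_skew_comp (S : EuclideanSpace ℝ (Fin 3) →L[ℝ] EuclideanSpace ℝ (Fin 3))
    {V : EuclideanSpace ℝ (Fin 3) → EuclideanSpace ℝ (Fin 3)} {y : EuclideanSpace ℝ (Fin 3)}
    (hV : DifferentiableAt ℝ V y) :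
    curl (fun z => S (V z)) y = curlCLM (S.comp (fderiv ℝ V y)) := by
  have h : HasFDerivAt (fun z => S (V z)) (S.comp (fderiv ℝ V y)) y := S.hasFDerivAt.comp y hV.hasFDerivAt
  rw [curl_eq_curlCLM, h.fderiv]

/-- **`curl ((Sy·∇)V)(y) = curlCLM (DV(y) ∘ S) + DΩ(y)[Sy]`** for `V ∈ C²(ℝ³; ℝ³)` and a linear `S`: product rule and the
symmetry of `D²V` (the twin of the tree's `curl_fderiv_apply_self`, which is the case `S = 1`). [folklore] -/
theorem curl_fderiv_apply_skew (S : EuclideanSpace ℝ (Fin 3) →L[ℝ] EuclideanSpace ℝ (Fin 3))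
    {V : EuclideanSpace ℝ (Fin 3) → EuclideanSpace ℝ (Fin 3)} (hV : ContDiff ℝ 2 V) (y : EuclideanSpace ℝ (Fin 3)) :
    curl (fun z => fderiv ℝ V z (S z)) y = curlCLM ((fderiv ℝ V y).comp S) + fderiv ℝ (curl V) y (S y) := by
  have hD : HasFDerivAt (fderiv ℝ V) (fderiv ℝ (fderiv ℝ V) y) y :=
    (((hV.fderiv_right (m := 1) (by norm_num)).differentiable one_ne_zero).differentiableAt).hasFDerivAt
  have hg : HasFDerivAt (fun z => fderiv ℝ V z (S z))
      ((fderiv ℝ V y).comp S + (fderiv ℝ (fderiv ℝ V) y).flip (S y)) y :=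
    hD.clm_apply S.hasFDerivAt
  have hsymm : (fderiv ℝ (fderiv ℝ V) y).flip (S y) = fderiv ℝ (fderiv ℝ V) y (S y) := by
    ext k i
    rw [ContinuousLinearMap.flip_apply]
    exact congrFun (congrArg _ ((hV.contDiffAt.isSymmSndFDerivAt (by simp)) k (S y))) i
  rw [curl_eq_curlCLM, hg.fderiv, map_add, hsymm, fderiv_curl hV y, ContinuousLinearMap.comp_apply]

/-! ### The spiral vorticity identity -/

/-- The pressure of a classical spiral profile is `C²`: `∇P = −((1−γ)V − SV + (W_S·∇)V)` is `C¹` for `V ∈ C²`.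
[cite: ConstantinIgnatovaVicol2026Putative, §3.1.1 eq. (3.3)] -/
theorem contDiff_two_pressure_of_spiralProfile (hV : ContDiff ℝ 2 V) (hP : ContDiff ℝ 1 P)
    (heq : ∀ y, (1 - γ) • V y - S (V y) + fderiv ℝ V y (V y + γ • y + S y) + gradient P y = 0) :
    ContDiff ℝ 2 P := by
  have hgrad_eq : gradient P = fun y => -((1 - γ) • V y - S (V y) + fderiv ℝ V y (V y + γ • y + S y)) :=
    funext fun y => eq_neg_of_add_eq_zero_right (heq y)
  have hV1 : ContDiff ℝ 1 V := hV.of_le (by norm_num)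
  have hDV : ContDiff ℝ 1 (fderiv ℝ V) := hV.fderiv_right (m := 1) (by norm_num)
  have hW : ContDiff ℝ 1 fun y => V y + γ • y + S y := (hV1.add (contDiff_id.const_smul γ)).add S.contDiff
  have hgrad : ContDiff ℝ 1 (gradient P) := by
    rw [hgrad_eq]
    exact (((hV1.const_smul (1 - γ)).sub (S.contDiff.comp hV1)).add (hDV.clm_apply hW)).neg
  have hfd : ContDiff ℝ 1 (fderiv ℝ P) := by
    rw [← toDual_comp_gradient]
    exact (toDual ℝ (EuclideanSpace ℝ (Fin 3))).contDiff.comp hgrad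
  have h2 : ContDiff ℝ ((1 : WithTop ℕ∞) + 1) P :=
    contDiff_succ_iff_fderiv.2 ⟨hP.differentiable one_ne_zero, fun h1 => absurd h1 (by simp), hfd⟩
  exact h2.of_le (by norm_num)

/-- **THE SPIRAL VORTICITY IDENTITY.**  For a classical spiral profile (`V ∈ C²`, `P ∈ C¹`, `div V = 0`,
`(1−γ)V − SV + (W_S·∇)V + ∇P = 0`, `W_S(y) = V(y) + γy + Sy`, `S` skew-adjoint) the vorticity `Ω = curl V` satisfies
`DΩ(y)[W_S y] = DV(y)[Ω y] − Ω y + S(Ω y)`, i.e. `(W_S·∇)Ω = (Ω·∇)V − Ω + SΩ` — the curl of the profile equation: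
`curl((1−γ)V) = (1−γ)Ω`, `curl(γ(y·∇)V) = γΩ + γ(y·∇)Ω`, `curl((V·∇)V) = (V·∇)Ω − (Ω·∇)V` (`div V = 0`),
`curl(−SV + (Sy·∇)V) = (Sy·∇)Ω − SΩ` (`curlCLM_comp_sub_comp_of_skew`), `curl ∇P = 0`.
[cite: PineauVicol2026, §3 proof of Prop. 3.1, eq. (3.3) (Navier–Stokes analogue, J = rotation about e₃)] -/
theorem spiral_vorticity_identity (hS : ∀ x y : EuclideanSpace ℝ (Fin 3), ⟪S x, y⟫ = -⟪x, S y⟫)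
    (hV : ContDiff ℝ 2 V) (hP : ContDiff ℝ 1 P) (hdiv : VectorCalculus.IsDivFree V)
    (heq : ∀ y, (1 - γ) • V y - S (V y) + fderiv ℝ V y (V y + γ • y + S y) + gradient P y = 0)
    (y : EuclideanSpace ℝ (Fin 3)) :
    fderiv ℝ (curl V) y (V y + γ • y + S y) = fderiv ℝ V y (curl V y) - curl V y + S (curl V y) := by
  have hP2 : ContDiff ℝ 2 P := contDiff_two_pressure_of_spiralProfile hV hP heq
  -- differentiability of the summands at `y`
  have hd : DifferentiableAt ℝ (fderiv ℝ V) y :=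
    ((hV.fderiv_right (m := 1) (by norm_num)).differentiable one_ne_zero).differentiableAt
  have dU : DifferentiableAt ℝ V y := (hV.differentiable (by norm_num)) y
  have dSU : DifferentiableAt ℝ (fun z => S (V z)) y := S.differentiableAt.comp y dU
  have dA : DifferentiableAt ℝ (fun z => fderiv ℝ V z z) y := hd.clm_apply differentiableAt_id
  have dB : DifferentiableAt ℝ (fun z => fderiv ℝ V z (S z)) y := hd.clm_apply S.differentiableAt
  have dC : DifferentiableAt ℝ (fun z => fderiv ℝ V z (V z)) y := hd.clm_apply dU
  have dP : DifferentiableAt ℝ (gradient P) y := by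
    have h1 : DifferentiableAt ℝ (fderiv ℝ P) y :=
      ((hP2.fderiv_right (m := 1) (by norm_num)).differentiable one_ne_zero).differentiableAt
    exact ((toDual ℝ (EuclideanSpace ℝ (Fin 3))).symm.differentiable.differentiableAt).comp y h1
  -- the curls of the summands
  have c1 : curl (fun z => (1 - γ) • V z) y = (1 - γ) • curl V y := curl_const_smul dU _
  have c2 : curl (fun z => γ • fderiv ℝ V z z) y = γ • (curl V y + fderiv ℝ (curl V) y y) := by
    rw [curl_const_smul dA, curl_fderiv_apply_self hV]
  have c3 : curl (fun z => S (V z)) y = curlCLM (S.comp (fderiv ℝ V y)) := curl_skew_comp S dU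
  have c4 : curl (fun z => fderiv ℝ V z (V z)) y = fderiv ℝ (curl V) y (V y) - fderiv ℝ V y (curl V y) :=
    curl_convect_self_of_isDivFree hV hdiv y
  have c5 : curl (fun z => fderiv ℝ V z (S z)) y = curlCLM ((fderiv ℝ V y).comp S) + fderiv ℝ (curl V) y (S y) :=
    curl_fderiv_apply_skew S hV y
  have c6 : curl (gradient P) y = 0 := curl_gradient_eq_zero_holds P hP2 y
  have calg : curlCLM ((fderiv ℝ V y).comp S) - curlCLM (S.comp (fderiv ℝ V y)) = -(S (curl V y)) := by
    rw [← map_sub, curlCLM_comp_sub_comp_of_skew hS, curl_eq_curlCLM]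
  -- the profile equation as an identity of functions, regrouped, and its curl
  have hF : (fun z => (1 - γ) • V z - S (V z) +
      (fderiv ℝ V z (V z) + γ • fderiv ℝ V z z + fderiv ℝ V z (S z)) + gradient P z) =
      fun _ => (0 : EuclideanSpace ℝ (Fin 3)) := by
    funext z
    have e := heq z
    rw [map_add, map_add, map_smul] at e
    exact e
  have dM : DifferentiableAt ℝ (fun z => fderiv ℝ V z (V z) + γ • fderiv ℝ V z z + fderiv ℝ V z (S z)) y :=
    (dC.fun_add (dA.fun_const_smul γ)).fun_add dB
  have hcurl := congrArg (fun f => curl f y) hF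
  simp only [curl_fun_zero] at hcurl
  rw [curl_add (((dU.fun_const_smul _).fun_sub dSU).fun_add dM) dP,
    curl_add ((dU.fun_const_smul _).fun_sub dSU) dM, curl_sub (dU.fun_const_smul _) dSU,
    curl_add (dC.fun_add (dA.fun_const_smul γ)) dB, curl_add dC (dA.fun_const_smul γ),
    c1, c2, c3, c4, c5, c6] at hcurl
  -- conclude
  have key : fderiv ℝ (curl V) y (V y + γ • y + S y) - (fderiv ℝ V y (curl V y) - curl V y + S (curl V y)) =
      (1 - γ) • curl V y - curlCLM (S.comp (fderiv ℝ V y)) +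
        (fderiv ℝ (curl V) y (V y) - fderiv ℝ V y (curl V y) + γ • (curl V y + fderiv ℝ (curl V) y y) +
          (curlCLM ((fderiv ℝ V y).comp S) + fderiv ℝ (curl V) y (S y))) + 0 := by
    have e2 : curlCLM ((fderiv ℝ V y).comp S) = curlCLM (S.comp (fderiv ℝ V y)) - S (curl V y) := by
      rw [sub_eq_iff_eq_add.1 calg]
      abel
    rw [e2, map_add, map_add, map_smul]
    module
  rw [← sub_eq_zero, key, hcurl]

/-! ### The spiral wind: derivative, divergence, and the commutator with the vorticity -/

/-- The spiral wind `W_S(y) = V(y) + γy + Sy` is differentiable with `DW_S(y) = DV(y) + γ·1 + S`. [folklore] -/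
theorem hasFDerivAt_spiralWind (hVd : Differentiable ℝ V) (y : EuclideanSpace ℝ (Fin 3)) :
    HasFDerivAt (fun z => V z + γ • z + S z)
      (fderiv ℝ V y + γ • ContinuousLinearMap.id ℝ (EuclideanSpace ℝ (Fin 3)) + S) y :=
  ((hVd y).hasFDerivAt.add ((ContinuousLinearMap.id ℝ _).hasFDerivAt.const_smul γ)).add S.hasFDerivAt

/-- `DW_S(y) = DV(y) + γ·1 + S`. [folklore] -/
theorem fderiv_spiralWind (hVd : Differentiable ℝ V) (y : EuclideanSpace ℝ (Fin 3)) :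
    fderiv ℝ (fun z => V z + γ • z + S z) y =
      fderiv ℝ V y + γ • ContinuousLinearMap.id ℝ (EuclideanSpace ℝ (Fin 3)) + S :=
  (hasFDerivAt_spiralWind hVd y).fderiv

/-- **`div W_S = 3γ`** for a differentiable divergence-free `V` and a skew-adjoint `S` (`tr DV = 0`, `tr S = 0`): the
spiral similarity flow expands Lebesgue measure at the exact rate `e^{3γs}`, independently of the twist. [folklore] -/
theorem divergence_spiralWind (hS : ∀ x y : EuclideanSpace ℝ (Fin 3), ⟪S x, y⟫ = -⟪x, S y⟫)
    (hVd : Differentiable ℝ V) (hdiv : VectorCalculus.IsDivFree V) (y : EuclideanSpace ℝ (Fin 3)) :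
    VectorCalculus.divergence (fun z => V z + γ • z + S z) y = 3 * γ := by
  rw [VectorCalculus.divergence, fderiv_spiralWind hVd y]
  have h0 : LinearMap.trace ℝ _ (fderiv ℝ V y : EuclideanSpace ℝ (Fin 3) →ₗ[ℝ] EuclideanSpace ℝ (Fin 3)) = 0 :=
    hdiv y
  have hc : ((fderiv ℝ V y + γ • ContinuousLinearMap.id ℝ (EuclideanSpace ℝ (Fin 3)) + S :
        EuclideanSpace ℝ (Fin 3) →L[ℝ] EuclideanSpace ℝ (Fin 3)) :
        EuclideanSpace ℝ (Fin 3) →ₗ[ℝ] EuclideanSpace ℝ (Fin 3)) =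
      (fderiv ℝ V y : EuclideanSpace ℝ (Fin 3) →ₗ[ℝ] EuclideanSpace ℝ (Fin 3)) + γ • LinearMap.id +
        (S : EuclideanSpace ℝ (Fin 3) →ₗ[ℝ] EuclideanSpace ℝ (Fin 3)) := rfl
  rw [hc, map_add, map_add, map_smul, h0, trace_skew_eq_zero hS, LinearMap.trace_id, finrank_euclideanSpace,
    Fintype.card_fin]
  norm_num
  ring

/-- **The commutator identity `[W_S, Ω] = −(1+γ)Ω` for spiral profiles**: `DΩ(y)[W_S y] − DW_S(y)[Ω y] = −(1+γ)Ω(y)` —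
the infinitesimal self-similar Cauchy formula, VERBATIM as in the untwisted case (the twist `SΩ` of the spiral vorticity
identity cancels against the `S` inside `DW_S`): along the flow `Φ_s` of `W_S`, `Ω(Φ_s y) = e^{−(1+γ)s} DΦ_s(y) Ω(y)`.
[cite: ConstantinIgnatovaVicol2026Putative, §3.4.1 eq. (3.22)] -/
theorem fderiv_curl_spiralWind_sub (hS : ∀ x y : EuclideanSpace ℝ (Fin 3), ⟪S x, y⟫ = -⟪x, S y⟫)
    (hV : ContDiff ℝ 2 V) (hP : ContDiff ℝ 1 P) (hdiv : VectorCalculus.IsDivFree V)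
    (heq : ∀ y, (1 - γ) • V y - S (V y) + fderiv ℝ V y (V y + γ • y + S y) + gradient P y = 0)
    (y : EuclideanSpace ℝ (Fin 3)) :
    fderiv ℝ (curl V) y (V y + γ • y + S y) - fderiv ℝ (fun z => V z + γ • z + S z) y (curl V y) =
      -((1 + γ) • curl V y) := by
  have hVd : Differentiable ℝ V := hV.differentiable (by norm_num)
  rw [fderiv_spiralWind hVd y, spiral_vorticity_identity hS hV hP hdiv heq y]
  rw [_root_.add_apply, _root_.add_apply, _root_.smul_apply, ContinuousLinearMap.id_apply]
  module

end Summit.NavierStokesRegularity.NavierStokesRegularity.Theorems.PowerGaugeEulerLiouville.Spiral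

end
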